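import Literature.ComputerArithmetic.Higham2002.Gamma

/-!
# Rounding error of Horner's rule (Higham §5.1; Graillat–Jézéquel 2020, §6.1)

HONEST FRAMING (ENGINES group, unit `eng-quad-4`, kernels lane of the `certquad` engine): the
kernels' trust bound ASSUMES the standard model `fl(a ∘ b) = (a ∘ b)(1 + δ)`, `|δ| ≤ u`, for every
lane operation; this file types and proves the textbook consequence of that model for polynomial
evaluation by Horner's rule, so that "Horner in working precision is accurate to `γ₂ₙ · cond(p, x)`"
is a checked statement with its hypotheses visible. No hardware, vendor, timing or format claims:
the `δ`'s are hypotheses exactly as in the sources (and as in `Summation.lean`), to be discharged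
per format elsewhere.

Typed and PROVED, in MODEL form, for `p(x) = Σ_{i ≤ n} aᵢ xⁱ` evaluated by Horner's rule
`sₙ = aₙ`, `sᵢ = fl(fl(sᵢ₊₁ · x) + aᵢ)` (`i = n - 1, …, 0`), `res = s₀`
[GraillatJezequel2020, §6.1 Algorithm 12; Higham2002ASNA, §5.1]:

* `abs_hornerFl_sub_sum_le` — with `fl(s · x) = s x (1 + εᵢ)`, `fl(t + aᵢ) = (t + aᵢ)(1 + δᵢ)`,
  `|εᵢ|, |δᵢ| ≤ v`: `|res - p(x)| ≤ ((1 + v)^{2n} - 1) · p̃(|x|)`, `p̃(t) := Σ_{i ≤ n} |aᵢ| tⁱ`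
  (the product form behind Higham's `θ₂ₙ` bookkeeping);
* `abs_hornerFl_sub_sum_le_gamma` — if `2n · v < 1` then `|res - p(x)| ≤ γ₂ₙ(v) · p̃(|x|)`
  [Higham2002ASNA, §5.1 p. 95; GraillatJezequel2020, §6.1, the display preceding eq. (8)];
* `condPoly`, `abs_hornerFl_sub_sum_div_le` — `cond(p, x) := p̃(|x|) / |p(x)|` and
  `|res - p(x)| / |p(x)| ≤ γ₂ₙ(v) · cond(p, x)` [GraillatJezequel2020, §6.1 eq. (8) and the
  display following it];
* `abs_hornerFMA_sub_sum_le(_gamma)` — with a fused multiply-add, `sᵢ = fl(sᵢ₊₁ · x + aᵢ)` (ONE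
  rounding per step), the factor is `(1 + v)ⁿ - 1 ≤ γₙ(v)` [GraillatJezequel2020, §6.1, closing
  remark on FMA; Higham2002ASNA, §5.1];
* `hornerRd_le_sum`, `sum_le_hornerRd`, `hornerRd_enclosure` — the directed-rounding ENCLOSURE:
  if `x ≥ 0` and every operation result is rounded downward (`rd t ≤ t` for all `t`) the computed
  value is `≤ p(x)`, rounded upward it is `≥ p(x)`; hence `Einf ≤ p(x) ≤ Esup`
  [GraillatJezequel2020, §6.1 Algorithm 13 and Proposition 6.1]. Only `x ≥ 0` and the SIGN of each
  rounding are used — `rd` is an arbitrary map `K → K` (no monotonicity, no error model), so the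
  statement covers gradual underflow.

The parameter `v` is the per-operation relative error bound of the arithmetic: `v = u` (unit
roundoff) under round-to-nearest (Higham's standard model); [GraillatJezequel2020, §2] records
`|ε| ≤ 2u` under a directed rounding, whence the `γ₂ₙ(2u)` printed in their §6.1. Degree `n`
means `2n` rounded operations (`n` with FMA); `γ_k(v) = k v / (1 - k v)` is `gamma v k` of
`Gamma.lean`, whose `one_add_pow_sub_one_le_gamma` (`(1 + v)^k - 1 ≤ γ_k`) converts the product
form into the `γ` form. The Higham page locator is the one cited by [GraillatJezequel2020, §6.1]
("see [16, p. 95]"). Ordered field `K` arbitrary (`ℚ` for exact tables, `ℝ` for the textbook).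

ENCODING. Horner's rule is written by recursion on the degree with the coefficient sequence
shifted: `p(x) = x · q(x) + a₀` with `q(x) = Σ_{i < n} aᵢ₊₁ xⁱ` (`sum_mul_pow_succ_eq`), so
`hornerFl x a ε δ (n + 1) = (hornerFl x (a ∘ succ) (ε ∘ succ) (δ ∘ succ) n · x · (1 + ε 0) + a 0)
· (1 + δ 0)` is literally `s₀ = fl(fl(s₁ · x) + a₀)` with `s₁` the Horner value of `q`; `ε i`, `δ i`
are the relative errors committed at step `i` of Algorithm 12. With all errors zero the model IS
exact Horner, which IS `p(x)` (`hornerFl_eq_horner`, `horner_eq_sum`).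

NOT HERE: Higham's running (a posteriori) error bound for Horner (his Algorithm 5.1) and the
backward-error reading of the `θ` bookkeeping; the first-order constants without the `γ`
denominator (cf. [GraillatJezequel2020, Remark 2]); the compensated Horner scheme
([GraillatJezequel2020, Algorithm 14, Proposition 6.2]), which needs error-free transformations.
-/

namespace Literature.ComputerArithmetic.Higham2002

open Finset

variable {K : Type*} [Field K] [LinearOrder K] [IsStrictOrderedRing K]

/-! ## Exact Horner and the polynomial value -/

/-- Horner's rule evaluated EXACTLY: `sₙ = aₙ`, `sᵢ = sᵢ₊₁ · x + aᵢ`, by recursion on the degree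
with shifted coefficients (`horner x a (n+1) = horner x (a ∘ succ) n · x + a 0`).
[cite: GraillatJezequel2020, §6.1 Algorithm 12] -/
def horner (x : K) : (ℕ → K) → ℕ → K
  | a, 0 => a 0
  | a, n + 1 => horner x (fun i => a (i + 1)) n * x + a 0

omit [LinearOrder K] [IsStrictOrderedRing K] in
/-- Horner's recurrence on the polynomial value: `Σ_{i ≤ n+1} fᵢ yⁱ = (Σ_{i ≤ n} fᵢ₊₁ yⁱ) · y + f₀`.
[cite: GraillatJezequel2020, §6.1 Algorithm 12] -/
theorem sum_mul_pow_succ_eq (f : ℕ → K) (y : K) (n : ℕ) :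
    ∑ i ∈ range (n + 1 + 1), f i * y ^ i = (∑ i ∈ range (n + 1), f (i + 1) * y ^ i) * y + f 0 := by
  rw [Finset.sum_range_succ', Finset.sum_mul]
  simp only [pow_zero, mul_one, pow_succ, mul_assoc]

omit [LinearOrder K] [IsStrictOrderedRing K] in
/-- Exact Horner computes `p(x) = Σ_{i ≤ n} aᵢ xⁱ`. [cite: GraillatJezequel2020, §6.1 Algorithm 12] -/
theorem horner_eq_sum (x : K) :
    ∀ (n : ℕ) (a : ℕ → K), horner x a n = ∑ i ∈ range (n + 1), a i * x ^ i
  | 0, a => by simp [horner]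
  | n + 1, a => by
      simp only [horner]
      rw [horner_eq_sum x n, sum_mul_pow_succ_eq]

/-- `|Σ_{i ≤ n} aᵢ xⁱ| ≤ p̃(|x|) = Σ_{i ≤ n} |aᵢ| |x|ⁱ`. [cite: GraillatJezequel2020, §6.1 eq. (8)] -/
theorem abs_sum_le_sum_abs_mul_abs_pow (a : ℕ → K) (x : K) (n : ℕ) :
    |∑ i ∈ range (n + 1), a i * x ^ i| ≤ ∑ i ∈ range (n + 1), |a i| * |x| ^ i := by
  refine le_trans (Finset.abs_sum_le_sum_abs _ _) (le_of_eq (Finset.sum_congr rfl fun i _ => ?_))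
  rw [abs_mul, abs_pow]

/-! ## Horner's rule in the rounding-error model (two roundings per step) -/

/-- Horner's rule in the rounding-error MODEL: `sₙ = aₙ`,
`sᵢ = ((sᵢ₊₁ · x)(1 + εᵢ) + aᵢ)(1 + δᵢ)` — the product rounded with relative error `εᵢ`, the sum
with `δᵢ` — encoded by recursion on the degree with shifted coefficient / error sequences;
`hornerFl x a ε δ n` is `res = s₀` for `p(x) = Σ_{i ≤ n} aᵢ xⁱ`.
[cite: GraillatJezequel2020, §6.1 Algorithm 12] [cite: Higham2002ASNA, §5.1 p. 95] -/
def hornerFl (x : K) : (ℕ → K) → (ℕ → K) → (ℕ → K) → ℕ → K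
  | a, _, _, 0 => a 0
  | a, ε, δ, n + 1 =>
      (hornerFl x (fun i => a (i + 1)) (fun i => ε (i + 1)) (fun i => δ (i + 1)) n * x * (1 + ε 0)
        + a 0) * (1 + δ 0)

omit [LinearOrder K] [IsStrictOrderedRing K] in
/-- With all relative errors zero the model is exact Horner.
[cite: GraillatJezequel2020, §6.1 Algorithm 12] -/
theorem hornerFl_eq_horner (x : K) :
    ∀ (n : ℕ) (a ε δ : ℕ → K), (∀ k, ε k = 0) → (∀ k, δ k = 0) → hornerFl x a ε δ n = horner x a n
  | 0, _, _, _, _, _ => rfl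
  | n + 1, a, ε, δ, hε, hδ => by
      simp only [hornerFl, horner, hε 0, hδ 0, add_zero, mul_one]
      rw [hornerFl_eq_horner x n _ _ _ (fun k => hε (k + 1)) (fun k => hδ (k + 1))]

/-- ONE HORNER STEP, error propagation (two roundings): if `|H - E| ≤ (q - 1) P`, `|E| ≤ P`,
`q ≥ 1`, `|e|, |d| ≤ v`, then `|(H x (1 + e) + c)(1 + d) - (E x + c)| ≤ (q (1 + v)² - 1)(P |x| + |c|)`.
[cite: Higham2002ASNA, §5.1 p. 95] -/
theorem abs_horner_step_sub_le {v q H E P x e d c : K} (hv : 0 ≤ v) (hq : 1 ≤ q)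
    (hHE : |H - E| ≤ (q - 1) * P) (hEP : |E| ≤ P) (he : |e| ≤ v) (hd : |d| ≤ v) :
    |(H * x * (1 + e) + c) * (1 + d) - (E * x + c)| ≤ (q * (1 + v) ^ 2 - 1) * (P * |x| + |c|) := by
  have hP0 : 0 ≤ P := le_trans (abs_nonneg _) hEP
  have hx0 := abs_nonneg x
  have hc0 := abs_nonneg c
  have he' := abs_le.mp he
  have hd' := abs_le.mp hd
  have h1e : |1 + e| ≤ 1 + v := by rw [abs_le]; constructor <;> linarith
  have h1d : |1 + d| ≤ 1 + v := by rw [abs_le]; constructor <;> linarith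
  have hprod : |(1 + e) * (1 + d)| ≤ (1 + v) ^ 2 := by
    rw [abs_mul, pow_two]; exact mul_le_mul h1e h1d (abs_nonneg _) (by linarith)
  have hprod1 : |(1 + e) * (1 + d) - 1| ≤ (1 + v) ^ 2 - 1 := by
    rw [show (1 + e) * (1 + d) - 1 = e + d + e * d by ring]
    have hm : |e * d| ≤ v * v := by rw [abs_mul]; exact mul_le_mul he hd (abs_nonneg _) hv
    calc |e + d + e * d| ≤ |e| + |d| + |e * d| :=
          le_trans (abs_add_le _ _) (add_le_add (abs_add_le _ _) le_rfl)
      _ ≤ v + v + v * v := add_le_add (add_le_add he hd) hm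
      _ = (1 + v) ^ 2 - 1 := by ring
  have key : (H * x * (1 + e) + c) * (1 + d) - (E * x + c)
      = (H - E) * x * ((1 + e) * (1 + d)) + E * x * ((1 + e) * (1 + d) - 1) + c * d := by ring
  rw [key]
  have hq0 : 0 ≤ q - 1 := by linarith
  have h1 : |(H - E) * x * ((1 + e) * (1 + d))| ≤ (q - 1) * P * |x| * (1 + v) ^ 2 := by
    rw [abs_mul ((H - E) * x), abs_mul (H - E)]
    exact mul_le_mul (mul_le_mul_of_nonneg_right hHE hx0) hprod (abs_nonneg _)
      (mul_nonneg (mul_nonneg hq0 hP0) hx0)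
  have h2 : |E * x * ((1 + e) * (1 + d) - 1)| ≤ P * |x| * ((1 + v) ^ 2 - 1) := by
    rw [abs_mul (E * x), abs_mul E]
    exact mul_le_mul (mul_le_mul_of_nonneg_right hEP hx0) hprod1 (abs_nonneg _)
      (mul_nonneg hP0 hx0)
  have h3 : |c * d| ≤ |c| * v := by
    rw [abs_mul]; exact mul_le_mul_of_nonneg_left hd hc0
  have hpow : v ≤ q * (1 + v) ^ 2 - 1 := by
    have : 0 ≤ (q - 1) * (1 + v) ^ 2 + v * v :=
      add_nonneg (mul_nonneg hq0 (sq_nonneg _)) (mul_nonneg hv hv)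
    nlinarith [this]
  calc |(H - E) * x * ((1 + e) * (1 + d)) + E * x * ((1 + e) * (1 + d) - 1) + c * d|
      ≤ (q - 1) * P * |x| * (1 + v) ^ 2 + P * |x| * ((1 + v) ^ 2 - 1) + |c| * v :=
        le_trans (abs_add_le _ _) (add_le_add (le_trans (abs_add_le _ _) (add_le_add h1 h2)) h3)
    _ = (q * (1 + v) ^ 2 - 1) * (P * |x|) + |c| * v := by ring
    _ ≤ (q * (1 + v) ^ 2 - 1) * (P * |x|) + |c| * (q * (1 + v) ^ 2 - 1) := by
        have := mul_le_mul_of_nonneg_left hpow hc0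
        linarith
    _ = (q * (1 + v) ^ 2 - 1) * (P * |x| + |c|) := by ring

/-- HORNER'S RULE, sharp model bound: if `|εᵢ|, |δᵢ| ≤ v` then
`|res - Σ_{i ≤ n} aᵢ xⁱ| ≤ ((1 + v)^{2n} - 1) · Σ_{i ≤ n} |aᵢ| |x|ⁱ` (degree `n`, `2n` roundings).
[cite: Higham2002ASNA, §5.1 p. 95] [cite: GraillatJezequel2020, §6.1 Algorithm 12] -/
theorem abs_hornerFl_sub_sum_le {v : K} (hv : 0 ≤ v) (x : K) :
    ∀ (n : ℕ) (a ε δ : ℕ → K), (∀ k, |ε k| ≤ v) → (∀ k, |δ k| ≤ v) →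
      |hornerFl x a ε δ n - ∑ i ∈ range (n + 1), a i * x ^ i|
        ≤ ((1 + v) ^ (2 * n) - 1) * ∑ i ∈ range (n + 1), |a i| * |x| ^ i
  | 0, a, ε, δ, _, _ => by simp [hornerFl]
  | n + 1, a, ε, δ, hε, hδ => by
      have ih : |hornerFl x (fun i => a (i + 1)) (fun i => ε (i + 1)) (fun i => δ (i + 1)) n
            - ∑ i ∈ range (n + 1), a (i + 1) * x ^ i|
          ≤ ((1 + v) ^ (2 * n) - 1) * ∑ i ∈ range (n + 1), |a (i + 1)| * |x| ^ i :=
        abs_hornerFl_sub_sum_le hv x n _ _ _ (fun k => hε (k + 1)) (fun k => hδ (k + 1))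
      have hEP := abs_sum_le_sum_abs_mul_abs_pow (fun i => a (i + 1)) x n
      have hsum1 : ∑ i ∈ range (n + 1 + 1), a i * x ^ i
          = (∑ i ∈ range (n + 1), a (i + 1) * x ^ i) * x + a 0 := sum_mul_pow_succ_eq a x n
      have hsum2 : ∑ i ∈ range (n + 1 + 1), |a i| * |x| ^ i
          = (∑ i ∈ range (n + 1), |a (i + 1)| * |x| ^ i) * |x| + |a 0| :=
        sum_mul_pow_succ_eq (fun i => |a i|) |x| n
      have hpow : (1 + v) ^ (2 * (n + 1)) = (1 + v) ^ (2 * n) * (1 + v) ^ 2 := by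
        rw [show 2 * (n + 1) = 2 * n + 2 by ring, pow_add]
      simp only [hornerFl]
      rw [hsum1, hsum2, hpow]
      exact abs_horner_step_sub_le hv (one_le_pow₀ (by linarith)) ih hEP (hε 0) (hδ 0)

/-- HORNER'S RULE, `γ` form: if `|εᵢ|, |δᵢ| ≤ v` and `2n · v < 1` then
`|res - p(x)| ≤ γ₂ₙ(v) · p̃(|x|)`, `p̃(|x|) = Σ_{i ≤ n} |aᵢ| |x|ⁱ` — Higham's
`|p(x) - ŷ| ≤ γ₂ₙ Σ |aᵢ||x|ⁱ`; Graillat–Jézéquel print it with `v = 2u` (directed rounding).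
[cite: Higham2002ASNA, §5.1 p. 95] [cite: GraillatJezequel2020, §6.1 Algorithm 12] -/
theorem abs_hornerFl_sub_sum_le_gamma {v : K} (hv : 0 ≤ v) {n : ℕ}
    (hn : ((2 * n : ℕ) : K) * v < 1) (x : K) (a ε δ : ℕ → K) (hε : ∀ k, |ε k| ≤ v)
    (hδ : ∀ k, |δ k| ≤ v) :
    |hornerFl x a ε δ n - ∑ i ∈ range (n + 1), a i * x ^ i|
      ≤ gamma v (2 * n) * ∑ i ∈ range (n + 1), |a i| * |x| ^ i :=
  le_trans (abs_hornerFl_sub_sum_le hv x n a ε δ hε hδ)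
    (mul_le_mul_of_nonneg_right (one_add_pow_sub_one_le_gamma hv hn)
      (Finset.sum_nonneg fun _ _ => by positivity))

/-- The condition number of polynomial evaluation, `cond(p, x) = Σ |aᵢ| |x|ⁱ / |p(x)| = p̃(|x|) / |p(x)|`
(for `p(x) = 0` Lean's `y / 0 = 0` makes it `0`; the source assumes `p(x) ≠ 0`).
[cite: GraillatJezequel2020, §6.1 eq. (8)] -/
def condPoly (a : ℕ → K) (x : K) (n : ℕ) : K :=
  (∑ i ∈ range (n + 1), |a i| * |x| ^ i) / |∑ i ∈ range (n + 1), a i * x ^ i|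

/-- HORNER'S RULE, relative form: with `2n · v < 1`,
`|res - p(x)| / |p(x)| ≤ γ₂ₙ(v) · cond(p, x)` (both sides are `0` when `p(x) = 0`).
[cite: GraillatJezequel2020, §6.1 eq. (8)] [cite: Higham2002ASNA, §5.1 p. 95] -/
theorem abs_hornerFl_sub_sum_div_le {v : K} (hv : 0 ≤ v) {n : ℕ}
    (hn : ((2 * n : ℕ) : K) * v < 1) (x : K) (a ε δ : ℕ → K) (hε : ∀ k, |ε k| ≤ v)
    (hδ : ∀ k, |δ k| ≤ v) :
    |hornerFl x a ε δ n - ∑ i ∈ range (n + 1), a i * x ^ i| / |∑ i ∈ range (n + 1), a i * x ^ i|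
      ≤ gamma v (2 * n) * condPoly a x n := by
  unfold condPoly
  rw [← mul_div_assoc]
  exact div_le_div_of_nonneg_right (abs_hornerFl_sub_sum_le_gamma hv hn x a ε δ hε hδ)
    (abs_nonneg _)

/-! ## Horner's rule with a fused multiply-add (one rounding per step) -/

/-- Horner's rule with FMA in the rounding-error MODEL: `sₙ = aₙ`, `sᵢ = (sᵢ₊₁ · x + aᵢ)(1 + δᵢ)`
(ONE rounding per step). [cite: GraillatJezequel2020, §6.1 Algorithm 12] -/
def hornerFMA (x : K) : (ℕ → K) → (ℕ → K) → ℕ → K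
  | a, _, 0 => a 0
  | a, δ, n + 1 => (hornerFMA x (fun i => a (i + 1)) (fun i => δ (i + 1)) n * x + a 0) * (1 + δ 0)

/-- ONE FMA-HORNER STEP, error propagation: if `|H - E| ≤ (q - 1) P`, `|E| ≤ P`, `q ≥ 1`, `|d| ≤ v`,
then `|(H x + c)(1 + d) - (E x + c)| ≤ (q (1 + v) - 1)(P |x| + |c|)`.
[cite: Higham2002ASNA, §5.1 p. 95] -/
theorem abs_hornerFMA_step_sub_le {v q H E P x d c : K} (hv : 0 ≤ v) (hq : 1 ≤ q)
    (hHE : |H - E| ≤ (q - 1) * P) (hEP : |E| ≤ P) (hd : |d| ≤ v) :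
    |(H * x + c) * (1 + d) - (E * x + c)| ≤ (q * (1 + v) - 1) * (P * |x| + |c|) := by
  have hP0 : 0 ≤ P := le_trans (abs_nonneg _) hEP
  have hx0 := abs_nonneg x
  have hc0 := abs_nonneg c
  have hd' := abs_le.mp hd
  have h1d : |1 + d| ≤ 1 + v := by rw [abs_le]; constructor <;> linarith
  have key : (H * x + c) * (1 + d) - (E * x + c) = (H - E) * x * (1 + d) + (E * x + c) * d := by
    ring
  rw [key]
  have hq0 : 0 ≤ q - 1 := by linarith
  have h1 : |(H - E) * x * (1 + d)| ≤ (q - 1) * P * |x| * (1 + v) := by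
    rw [abs_mul ((H - E) * x), abs_mul (H - E)]
    exact mul_le_mul (mul_le_mul_of_nonneg_right hHE hx0) h1d (abs_nonneg _)
      (mul_nonneg (mul_nonneg hq0 hP0) hx0)
  have h2 : |(E * x + c) * d| ≤ (P * |x| + |c|) * v := by
    rw [abs_mul]
    refine mul_le_mul ?_ hd (abs_nonneg _) (by positivity)
    calc |E * x + c| ≤ |E * x| + |c| := abs_add_le _ _
      _ = |E| * |x| + |c| := by rw [abs_mul]
      _ ≤ P * |x| + |c| := add_le_add (mul_le_mul_of_nonneg_right hEP hx0) le_rfl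
  have hpow : v ≤ q * (1 + v) - 1 := by nlinarith
  calc |(H - E) * x * (1 + d) + (E * x + c) * d|
      ≤ (q - 1) * P * |x| * (1 + v) + (P * |x| + |c|) * v := le_trans (abs_add_le _ _) (add_le_add h1 h2)
    _ = (q * (1 + v) - 1) * (P * |x|) + |c| * v := by ring
    _ ≤ (q * (1 + v) - 1) * (P * |x|) + |c| * (q * (1 + v) - 1) := by
        have := mul_le_mul_of_nonneg_left hpow hc0
        linarith
    _ = (q * (1 + v) - 1) * (P * |x| + |c|) := by ring

/-- HORNER WITH FMA, sharp model bound: if `|δᵢ| ≤ v` then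
`|res - Σ_{i ≤ n} aᵢ xⁱ| ≤ ((1 + v)ⁿ - 1) · Σ_{i ≤ n} |aᵢ| |x|ⁱ` (degree `n`, `n` roundings).
[cite: GraillatJezequel2020, §6.1 Algorithm 12] [cite: Higham2002ASNA, §5.1 p. 95] -/
theorem abs_hornerFMA_sub_sum_le {v : K} (hv : 0 ≤ v) (x : K) :
    ∀ (n : ℕ) (a δ : ℕ → K), (∀ k, |δ k| ≤ v) →
      |hornerFMA x a δ n - ∑ i ∈ range (n + 1), a i * x ^ i|
        ≤ ((1 + v) ^ n - 1) * ∑ i ∈ range (n + 1), |a i| * |x| ^ i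
  | 0, a, δ, _ => by simp [hornerFMA]
  | n + 1, a, δ, hδ => by
      have ih : |hornerFMA x (fun i => a (i + 1)) (fun i => δ (i + 1)) n
            - ∑ i ∈ range (n + 1), a (i + 1) * x ^ i|
          ≤ ((1 + v) ^ n - 1) * ∑ i ∈ range (n + 1), |a (i + 1)| * |x| ^ i :=
        abs_hornerFMA_sub_sum_le hv x n _ _ (fun k => hδ (k + 1))
      have hEP := abs_sum_le_sum_abs_mul_abs_pow (fun i => a (i + 1)) x n
      have hsum1 : ∑ i ∈ range (n + 1 + 1), a i * x ^ i
          = (∑ i ∈ range (n + 1), a (i + 1) * x ^ i) * x + a 0 := sum_mul_pow_succ_eq a x n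
      have hsum2 : ∑ i ∈ range (n + 1 + 1), |a i| * |x| ^ i
          = (∑ i ∈ range (n + 1), |a (i + 1)| * |x| ^ i) * |x| + |a 0| :=
        sum_mul_pow_succ_eq (fun i => |a i|) |x| n
      simp only [hornerFMA]
      rw [hsum1, hsum2, pow_succ]
      exact abs_hornerFMA_step_sub_le hv (one_le_pow₀ (by linarith)) ih hEP (hδ 0)

/-- HORNER WITH FMA, `γ` form: if `|δᵢ| ≤ v` and `n · v < 1` then `|res - p(x)| ≤ γₙ(v) · p̃(|x|)`.
[cite: GraillatJezequel2020, §6.1 Algorithm 12] [cite: Higham2002ASNA, §5.1 p. 95] -/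
theorem abs_hornerFMA_sub_sum_le_gamma {v : K} (hv : 0 ≤ v) {n : ℕ} (hn : (n : K) * v < 1)
    (x : K) (a δ : ℕ → K) (hδ : ∀ k, |δ k| ≤ v) :
    |hornerFMA x a δ n - ∑ i ∈ range (n + 1), a i * x ^ i|
      ≤ gamma v n * ∑ i ∈ range (n + 1), |a i| * |x| ^ i :=
  le_trans (abs_hornerFMA_sub_sum_le hv x n a δ hδ)
    (mul_le_mul_of_nonneg_right (one_add_pow_sub_one_le_gamma hv hn)
      (Finset.sum_nonneg fun _ _ => by positivity))

/-! ## Directed rounding: enclosure of `p(x)` for `x ≥ 0` -/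

/-- Horner's rule with every operation result passed through a rounding map `rd : K → K`:
`sₙ = aₙ`, `sᵢ = rd(rd(sᵢ₊₁ · x) + aᵢ)` (Algorithm 12 run under one rounding mode, as in Algorithm 13).
[cite: GraillatJezequel2020, §6.1 Algorithm 13] -/
def hornerRd (rd : K → K) (x : K) : (ℕ → K) → ℕ → K
  | a, 0 => a 0
  | a, n + 1 => rd (rd (hornerRd rd x (fun i => a (i + 1)) n * x) + a 0)

/-- DOWNWARD ROUNDING UNDER-ESTIMATES for `x ≥ 0`: if `rd t ≤ t` for every `t` then
`Einf = hornerRd rd x a n ≤ p(x)`. [cite: GraillatJezequel2020, §6.1 Proposition 6.1] -/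
theorem hornerRd_le_sum {rd : K → K} (hrd : ∀ t, rd t ≤ t) {x : K} (hx : 0 ≤ x) :
    ∀ (n : ℕ) (a : ℕ → K), hornerRd rd x a n ≤ ∑ i ∈ range (n + 1), a i * x ^ i
  | 0, a => by simp [hornerRd]
  | n + 1, a => by
      have ih := hornerRd_le_sum hrd hx n (fun i => a (i + 1))
      simp only [hornerRd]
      rw [sum_mul_pow_succ_eq a x n]
      calc rd (rd (hornerRd rd x (fun i => a (i + 1)) n * x) + a 0)
          ≤ rd (hornerRd rd x (fun i => a (i + 1)) n * x) + a 0 := hrd _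
        _ ≤ hornerRd rd x (fun i => a (i + 1)) n * x + a 0 := add_le_add (hrd _) le_rfl
        _ ≤ (∑ i ∈ range (n + 1), a (i + 1) * x ^ i) * x + a 0 :=
            add_le_add (mul_le_mul_of_nonneg_right ih hx) le_rfl

/-- UPWARD ROUNDING OVER-ESTIMATES for `x ≥ 0`: if `t ≤ rd t` for every `t` then
`p(x) ≤ Esup = hornerRd rd x a n`. [cite: GraillatJezequel2020, §6.1 Proposition 6.1] -/
theorem sum_le_hornerRd {rd : K → K} (hrd : ∀ t, t ≤ rd t) {x : K} (hx : 0 ≤ x) :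
    ∀ (n : ℕ) (a : ℕ → K), ∑ i ∈ range (n + 1), a i * x ^ i ≤ hornerRd rd x a n
  | 0, a => by simp [hornerRd]
  | n + 1, a => by
      have ih := sum_le_hornerRd hrd hx n (fun i => a (i + 1))
      simp only [hornerRd]
      rw [sum_mul_pow_succ_eq a x n]
      calc (∑ i ∈ range (n + 1), a (i + 1) * x ^ i) * x + a 0
          ≤ hornerRd rd x (fun i => a (i + 1)) n * x + a 0 :=
            add_le_add (mul_le_mul_of_nonneg_right ih hx) le_rfl
        _ ≤ rd (hornerRd rd x (fun i => a (i + 1)) n * x) + a 0 := add_le_add (hrd _) le_rfl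
        _ ≤ rd (rd (hornerRd rd x (fun i => a (i + 1)) n * x) + a 0) := hrd _

/-- GRAILLAT–JÉZÉQUEL PROPOSITION 6.1 (model form): for `x ≥ 0`, Horner run with a downward rounding
`dn` (`dn t ≤ t`) and with an upward rounding `up` (`t ≤ up t`) encloses the value:
`Einf ≤ p(x) ≤ Esup`. [cite: GraillatJezequel2020, §6.1 Proposition 6.1] -/
theorem hornerRd_enclosure {dn up : K → K} (hdn : ∀ t, dn t ≤ t) (hup : ∀ t, t ≤ up t) {x : K}
    (hx : 0 ≤ x) (n : ℕ) (a : ℕ → K) :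
    hornerRd dn x a n ≤ ∑ i ∈ range (n + 1), a i * x ^ i
      ∧ ∑ i ∈ range (n + 1), a i * x ^ i ≤ hornerRd up x a n :=
  ⟨hornerRd_le_sum hdn hx n a, sum_le_hornerRd hup hx n a⟩

end Literature.ComputerArithmetic.Higham2002
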